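import Literature.NumberTheory.EllipticCurves.SzpiroLocalDataProofs
import Literature.NumberTheory.DiophantineGeometry.LocalReductionIsSemistableAtProofs

/-!
# Crux `RibetTakahashiSplit.SemistableDiscriminantPowerBound` (stmt-ABC-14771): negative-side facts

The crux (verbatim the named fact `Literature.NumberTheory.EllipticCurves.mestreOesterle1989_thm_1`,
Mestre–Oesterlé 1989, Théorème 1 + modularity of semistable curves) reads

  `∀ (W : WeierstrassCurve ℚ) [W.IsElliptic], W.IsSemistable ℤ → ∀ m k : ℕ, 2 ≤ k →`
  `W.minimalDiscriminantNorm ℤ = k ^ m → m ≤ 5`.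

Refuter (crux-attack) findings, kernel-checked:

* `semistableDiscriminantPowerBound_false_without_isSemistable` — the hypothesis
  `W.IsSemistable ℤ` is LOAD-BEARING: the congruent number curve `y² = x³ − x` (Cremona 32a2,
  additive at `2`) has `|Δ_min| = 64 = 2⁶`, so the statement with semistability dropped is false
  (`m = 6`, `k = 2`).
* `exists_isSemistable_minimalDiscriminantNorm_eq_pow_five` — NON-VACUITY and TIGHTNESS: the
  modular curve `X₀(11)` (`y² + y = x³ − x² − 10x − 20`, Cremona 11a1) is semistable
  (`(c₄, Δ) = (496, −11⁵) = (1)`) with `|Δ_min| = 11⁵`; hence the hypotheses of the crux are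
  satisfiable with `m = 5`, and the strengthening `m ≤ 4`
  (`SemistableDiscriminantPowerBoundLeFour`) is false: `not_semistableDiscriminantPowerBoundLeFour`.

Tools: `isMinimalAt_baseChange_int_of_not_pow_dvd_Δ` (Silverman AEC VII.1 Rem. 1.1),
`minimalDiscriminantNorm_eq_natAbs_holds` (AEC VIII.8), `isSemistable_baseChange_of_isCoprime`
(AEC VII.5 Prop. 5.1).
-/

set_option linter.dupNamespace false

namespace Summit.ABC.ABC.Theorems.SemistableDiscriminantPowerBound.Negative

open IsDedekindDomain WeierstrassCurve

/-! ## Dropping semistability: `y² = x³ − x` -/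

/-- The crux with the hypothesis `W.IsSemistable ℤ` dropped. -/
def SemistableDiscriminantPowerBoundWithoutIsSemistable : Prop :=
  ∀ (W : WeierstrassCurve ℚ) [W.IsElliptic], ∀ m k : ℕ, 2 ≤ k →
    W.minimalDiscriminantNorm ℤ = k ^ m → m ≤ 5

/-- The global minimal model `y² = x³ − x` of the congruent number curve (Cremona 32a2). -/
def congruentNumberModel : WeierstrassCurve ℤ := ⟨0, 0, 0, -1, 0⟩

/-- `Δ (y² = x³ − x) = 64`. [folklore] -/
theorem congruentNumberModel_Δ : congruentNumberModel.Δ = 64 := by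
  simp only [congruentNumberModel, WeierstrassCurve.Δ, WeierstrassCurve.b₂, WeierstrassCurve.b₄,
    WeierstrassCurve.b₆, WeierstrassCurve.b₈]
  norm_num

/-- `y² = x³ − x` over `ℤ` is minimal at every prime (`ord_p (64) < 12`). [folklore] -/
theorem isMinimalAt_congruentNumberModel (v : HeightOneSpectrum ℤ) :
    (congruentNumberModel.baseChange ℚ).IsMinimalAt v := by
  refine isMinimalAt_baseChange_int_of_not_pow_dvd_Δ fun h ↦ ?_
  rw [congruentNumberModel_Δ] at h
  have hp := (Rat.HeightOneSpectrum.prime_natGenerator v).two_le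
  have h64 : ((Rat.HeightOneSpectrum.natGenerator v : ℤ)) ^ 12 ≤ 64 := Int.le_of_dvd (by norm_num) h
  have h4 : (2 : ℤ) ^ 12 ≤ ((Rat.HeightOneSpectrum.natGenerator v : ℤ)) ^ 12 :=
    pow_le_pow_left₀ (by norm_num) (by exact_mod_cast hp) 12
  linarith

/-- `y² = x³ − x` is an elliptic curve over `ℚ`. [folklore] -/
instance isElliptic_congruentNumberModel : (congruentNumberModel.baseChange ℚ).IsElliptic := by
  refine ⟨isUnit_iff_ne_zero.mpr ?_⟩
  rw [baseChange_int_Δ, congruentNumberModel_Δ]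
  norm_num

/-- `|Δ_min (y² = x³ − x)| = 2⁶`. [folklore] -/
theorem minimalDiscriminantNorm_congruentNumberModel :
    (congruentNumberModel.baseChange ℚ).minimalDiscriminantNorm ℤ = 2 ^ 6 := by
  rw [minimalDiscriminantNorm_eq_natAbs_holds congruentNumberModel
      (by rw [congruentNumberModel_Δ]; norm_num) isMinimalAt_congruentNumberModel,
    congruentNumberModel_Δ]
  rfl

/-- **Semistability is load-bearing.** Without `W.IsSemistable ℤ` the crux fails: `y² = x³ − x`
(additive reduction at `2`) has `|Δ_min| = 2⁶` with `6 > 5`. Any proof of the crux must use the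
semistability hypothesis (as Mestre–Oesterlé do: `N` squarefree ⇒ `ρ̄_{E,ℓ}` finite at `p ∣ N`
when `ℓ ∣ v_p(Δ)`). -/
theorem semistableDiscriminantPowerBound_false_without_isSemistable :
    ¬ SemistableDiscriminantPowerBoundWithoutIsSemistable := fun h ↦ by
  have := h (congruentNumberModel.baseChange ℚ) 6 2 le_rfl
    (by rw [minimalDiscriminantNorm_congruentNumberModel])
  omega

/-! ## Tightness and non-vacuity: `X₀(11)` -/

/-- The global minimal model `y² + y = x³ − x² − 10x − 20` of `X₀(11)` (Cremona 11a1). -/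
def modularCurveX0Eleven : WeierstrassCurve ℤ := ⟨0, -1, 1, -10, -20⟩

/-- `Δ (X₀(11)) = −11⁵`. [folklore] -/
theorem modularCurveX0Eleven_Δ : modularCurveX0Eleven.Δ = -11 ^ 5 := by
  simp only [modularCurveX0Eleven, WeierstrassCurve.Δ, WeierstrassCurve.b₂, WeierstrassCurve.b₄,
    WeierstrassCurve.b₆, WeierstrassCurve.b₈]
  norm_num

/-- `c₄ (X₀(11)) = 496`. [folklore] -/
theorem modularCurveX0Eleven_c₄ : modularCurveX0Eleven.c₄ = 496 := by
  simp only [modularCurveX0Eleven, WeierstrassCurve.c₄, WeierstrassCurve.b₂, WeierstrassCurve.b₄]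
  norm_num

/-- `X₀(11)` is an elliptic curve over `ℚ`. [folklore] -/
instance isElliptic_modularCurveX0Eleven : (modularCurveX0Eleven.baseChange ℚ).IsElliptic := by
  refine ⟨isUnit_iff_ne_zero.mpr ?_⟩
  rw [baseChange_int_Δ, modularCurveX0Eleven_Δ]
  norm_num

/-- The model of `X₀(11)` is minimal at every prime (`ord_p (11⁵) < 12`). [folklore] -/
theorem isMinimalAt_modularCurveX0Eleven (v : HeightOneSpectrum ℤ) :
    (modularCurveX0Eleven.baseChange ℚ).IsMinimalAt v := by
  refine isMinimalAt_baseChange_int_of_not_pow_dvd_Δ fun h ↦ ?_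
  rw [modularCurveX0Eleven_Δ] at h
  set p : ℕ := Rat.HeightOneSpectrum.natGenerator v with hpdef
  have hp : p.Prime := Rat.HeightOneSpectrum.prime_natGenerator v
  have h1 : p ^ 12 ∣ 11 ^ 5 := by
    have h' := Int.natAbs_dvd_natAbs.mpr h
    simpa [Int.natAbs_pow] using h'
  have h2 : p ∣ 11 := hp.dvd_of_dvd_pow ((dvd_pow_self p (by norm_num)).trans h1)
  have h3 : p = 11 := (Nat.prime_dvd_prime_iff_eq hp (by norm_num)).mp h2
  rw [h3] at h1
  revert h1
  norm_num

/-- `X₀(11)` is semistable: `(c₄, Δ) = (496, −11⁵) = (2⁴·31, −11⁵)` are coprime. [folklore] -/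
theorem isSemistable_modularCurveX0Eleven : (modularCurveX0Eleven.baseChange ℚ).IsSemistable ℤ :=
  isSemistable_baseChange_of_isCoprime modularCurveX0Eleven
    (by rw [modularCurveX0Eleven_Δ]; norm_num)
    (by rw [modularCurveX0Eleven_c₄, modularCurveX0Eleven_Δ, Int.isCoprime_iff_gcd_eq_one]; norm_num)

/-- `|Δ_min (X₀(11))| = 11⁵`. [folklore] -/
theorem minimalDiscriminantNorm_modularCurveX0Eleven :
    (modularCurveX0Eleven.baseChange ℚ).minimalDiscriminantNorm ℤ = 11 ^ 5 := by
  rw [minimalDiscriminantNorm_eq_natAbs_holds modularCurveX0Eleven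
      (by rw [modularCurveX0Eleven_Δ]; norm_num) isMinimalAt_modularCurveX0Eleven,
    modularCurveX0Eleven_Δ]
  rfl

/-- **Non-vacuity / tightness witness.** There is a semistable elliptic curve over `ℚ` whose
minimal discriminant is a perfect fifth power (`X₀(11)`, `|Δ_min| = 11⁵`): the hypotheses of the
crux are satisfiable with `m = 5`, `k = 11`, and the printed bound `m ≤ 5` is attained. -/
theorem exists_isSemistable_minimalDiscriminantNorm_eq_pow_five :
    ∃ W : WeierstrassCurve ℚ, W.IsElliptic ∧ W.IsSemistable ℤ ∧
      W.minimalDiscriminantNorm ℤ = 11 ^ 5 :=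
  ⟨modularCurveX0Eleven.baseChange ℚ, inferInstance, isSemistable_modularCurveX0Eleven,
    minimalDiscriminantNorm_modularCurveX0Eleven⟩

/-- The natural strengthening of the crux with `m ≤ 4` in place of `m ≤ 5`. -/
def SemistableDiscriminantPowerBoundLeFour : Prop :=
  ∀ (W : WeierstrassCurve ℚ) [W.IsElliptic], W.IsSemistable ℤ → ∀ m k : ℕ, 2 ≤ k →
    W.minimalDiscriminantNorm ℤ = k ^ m → m ≤ 4

/-- **The bound `5` cannot be lowered**: the strengthening `m ≤ 4` is refuted by `X₀(11)`. -/
theorem not_semistableDiscriminantPowerBoundLeFour : ¬ SemistableDiscriminantPowerBoundLeFour :=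
  fun h ↦ by
    have := h (modularCurveX0Eleven.baseChange ℚ) isSemistable_modularCurveX0Eleven 5 11
      (by norm_num) minimalDiscriminantNorm_modularCurveX0Eleven
    omega

end Summit.ABC.ABC.Theorems.SemistableDiscriminantPowerBound.Negative
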